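import Mathlib.NumberTheory.Chebyshev
import Mathlib.NumberTheory.AbelSummation
import Mathlib.Analysis.SpecialFunctions.Pow.Deriv
import Mathlib.Analysis.SpecialFunctions.Integrals.Basic
import HarnessLib

/-!
# The prime tail `Σ_{p > N} p^{-σ} ≪ N^{1−σ}/((σ−1) log N)` from Chebyshev's bound (partial summation against `ϑ`)

Topic `Literature/NumberTheory/LFunctions` (proofs only; no definitions, no named facts). From Mathlib's
Chebyshev bound `ϑ(x) ≤ (log 4) x` (`Chebyshev.theta_le_log4_mul_x`) and Abel summation
(`sum_mul_eq_sub_sub_integral_mul'`, cumulative sums `Σ_{k ≤ n} [k prime] log k = ϑ(n)`), for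
`1 < σ ≤ 2` and naturals `2 ≤ N ≤ M`:

* `sum_Ioc_prime_log_mul_rpow_le` : `Σ_{N < p ≤ M} log p · p^{-σ} ≤ 3 log 4 · N^{1−σ}/(σ − 1)`
  (`= ϑ(M)M^{-σ} − ϑ(N)N^{-σ} + σ∫_N^M ϑ(⌊t⌋) t^{-σ−1} dt ≤ log 4 · M^{1−σ} + σ log 4 ∫_N^M t^{-σ} dt`);
* `sum_Ioc_prime_rpow_le` : `Σ_{N < p ≤ M} p^{-σ} ≤ 3 log 4 · N^{1−σ}/((σ − 1) log N)`;
* `tsum_primes_rpow_tail_le` : the same for the infinite tail `Σ_{p > N} p^{-σ}` over `Nat.Primes`.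

With `log N ≍ 1/(σ − 1)` the bound is `≪ 1`: this is the step "Since `|sin x| ≤ 1`, the sum over
`p ≥ e^{1/(σ−1)}` is `≪ Σ_{p > e^{1/(σ−1)}} p^{-σ} ≪ 1`" in the proof of Lemma 2 of Montgomery–Vaughan,
*Mean values of multiplicative functions* (2001), p. 209 (vendored as
`Literature.NumberTheory.LFunctions.MontgomeryVaughan2001_lemma2`; cf.
`MontgomeryVaughanLogMeansProofs.lean` for the reduction (20) and the range `|t| ≤ σ − 1`). Note that
the cruder comparison with all integers, `Σ_{n > N} n^{-σ} ≤ N^{1−σ}/(σ − 1)`, loses the factor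
`1/log N` and does not give `≪ 1` there.

## References

* P. L. Chebyshev (1852), `ϑ(x) ≪ x` — Mathlib `Mathlib.NumberTheory.Chebyshev`. [folklore]
* [MontgomeryVaughan2001] H. L. Montgomery, R. C. Vaughan, *Mean values of multiplicative functions*,
  Period. Math. Hungar. 43 (2001), proof of Lemma 2, p. 209 (read).
-/

noncomputable section

open Real Finset MeasureTheory
open scoped Chebyshev

namespace Literature.NumberTheory.LFunctions

/-- The cumulative sums of `k ↦ [k prime] log k` are Chebyshev's `ϑ`. [folklore] -/
theorem sum_Icc_ite_prime_log_eq_theta (n : ℕ) :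
    ∑ k ∈ Icc 0 n, (if k.Prime then Real.log k else 0) = θ (n : ℝ) := by
  rw [Chebyshev.theta_eq_sum_Icc, Nat.floor_natCast, sum_filter]

/-- **Partial summation against `ϑ` with Chebyshev's `ϑ(x) ≤ (log 4) x`:** for `1 < σ ≤ 2` and
naturals `2 ≤ N ≤ M`, `Σ_{N < p ≤ M} log p · p^{-σ} ≤ 3 log 4 · N^{1−σ}/(σ − 1)`
(Abel summation: `= ϑ(M)M^{-σ} − ϑ(N)N^{-σ} + σ∫_N^M ϑ(t) t^{-σ−1} dt ≤ log 4 · M^{1−σ} +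
σ log 4 ∫_N^M t^{-σ} dt`). [folklore] -/
theorem sum_Ioc_prime_log_mul_rpow_le {σ : ℝ} (hσ : 1 < σ) (hσ2 : σ ≤ 2) {N M : ℕ} (hN : 2 ≤ N)
    (hNM : N ≤ M) :
    ∑ p ∈ (Ioc N M).filter Nat.Prime, Real.log p * (p : ℝ) ^ (-σ) ≤
      3 * Real.log 4 * (N : ℝ) ^ (1 - σ) / (σ - 1) := by
  have hNr : (2 : ℝ) ≤ N := by exact_mod_cast hN
  have hNpos : (0 : ℝ) < N := by linarith
  have hNMr : (N : ℝ) ≤ M := by exact_mod_cast hNM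
  have hMpos : (0 : ℝ) < M := by linarith
  have hlog4 : 0 < Real.log 4 := Real.log_pos (by norm_num)
  have hσ1 : 0 < σ - 1 := by linarith
  set g : ℝ → ℝ := fun u ↦ u ^ (-σ) with hg
  -- the sum as an Abel sum
  have hsum : ∑ p ∈ (Ioc N M).filter Nat.Prime, Real.log p * (p : ℝ) ^ (-σ) =
      ∑ k ∈ Ioc N M, g k * (if k.Prime then Real.log k else 0) := by
    rw [sum_filter]
    refine sum_congr rfl fun k _ ↦ ?_
    simp only [hg]
    split_ifs <;> ring
  rw [hsum]
  -- derivative of `g`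
  have hgd : ∀ u : ℝ, 0 < u → HasDerivAt g (-σ * u ^ (-σ - 1)) u := fun u hu ↦ by
    simpa using Real.hasDerivAt_rpow_const (p := -σ) (Or.inl hu.ne')
  have hg_diff : ∀ u ∈ Set.Icc (N : ℝ) M, DifferentiableAt ℝ g u := fun u hu ↦
    (hgd u (by linarith [hu.1])).differentiableAt
  have hg_deriv : ∀ u : ℝ, 0 < u → deriv g u = -σ * u ^ (-σ - 1) := fun u hu ↦ (hgd u hu).deriv
  have hcont : ContinuousOn (fun u : ℝ ↦ -σ * u ^ (-σ - 1)) (Set.Icc (N : ℝ) M) :=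
    continuousOn_const.mul (continuousOn_id.rpow_const fun u hu ↦ Or.inl (by
      simp only [id]; linarith [hu.1]))
  have hg_int : IntegrableOn (deriv g) (Set.Icc (N : ℝ) M) := by
    refine (hcont.integrableOn_Icc).congr_fun (fun u hu ↦ ?_) measurableSet_Icc
    exact (hg_deriv u (by linarith [hu.1])).symm
  have habel := sum_mul_eq_sub_sub_integral_mul' (fun k ↦ if k.Prime then Real.log k else 0)
    hNM hg_diff hg_int
  simp_rw [sum_Icc_ite_prime_log_eq_theta] at habel
  rw [habel]
  -- the three pieces
  have hθM : θ (M : ℝ) ≤ Real.log 4 * M := Chebyshev.theta_le_log4_mul_x hMpos.le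
  have hθN : 0 ≤ θ (N : ℝ) := Chebyshev.theta_nonneg _
  have hT1 : g M * θ (M : ℝ) ≤ Real.log 4 * (N : ℝ) ^ (1 - σ) := by
    have hgM : 0 ≤ g M := Real.rpow_nonneg hMpos.le _
    calc g M * θ (M : ℝ) ≤ g M * (Real.log 4 * M) := mul_le_mul_of_nonneg_left hθM hgM
      _ = Real.log 4 * (M : ℝ) ^ (1 - σ) := by
          rw [hg, show (1 : ℝ) - σ = -σ + 1 by ring, Real.rpow_add_one hMpos.ne']; ring
      _ ≤ Real.log 4 * (N : ℝ) ^ (1 - σ) :=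
          mul_le_mul_of_nonneg_left (Real.rpow_le_rpow_of_nonpos hNpos hNMr (by linarith)) hlog4.le
  have hT2 : 0 ≤ g N * θ (N : ℝ) := mul_nonneg (Real.rpow_nonneg hNpos.le _) hθN
  have hT3 : ‖∫ t in Set.Ioc (N : ℝ) M, deriv g t * θ (⌊t⌋₊ : ℕ)‖ ≤
      σ * Real.log 4 * (N : ℝ) ^ (1 - σ) / (σ - 1) := by
    set bound : ℝ → ℝ := fun t ↦ σ * Real.log 4 * t ^ (-σ) with hbound
    have hbcont : ContinuousOn bound (Set.Icc (N : ℝ) M) :=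
      continuousOn_const.mul (continuousOn_id.rpow_const fun u hu ↦ Or.inl (by
        simp only [id]; linarith [hu.1]))
    have hbint : IntegrableOn bound (Set.Ioc (N : ℝ) M) :=
      (hbcont.integrableOn_Icc).mono_set Set.Ioc_subset_Icc_self
    have hle : ∀ᵐ t ∂(volume.restrict (Set.Ioc (N : ℝ) M)),
        ‖deriv g t * θ (⌊t⌋₊ : ℕ)‖ ≤ bound t := by
      rw [ae_restrict_iff' measurableSet_Ioc]
      refine Filter.Eventually.of_forall fun t ht ↦ ?_
      have ht0 : 0 < t := by linarith [ht.1]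
      have hfl : θ ((⌊t⌋₊ : ℕ) : ℝ) ≤ Real.log 4 * t :=
        (Chebyshev.theta_le_log4_mul_x (Nat.cast_nonneg _)).trans
          (mul_le_mul_of_nonneg_left (Nat.floor_le ht0.le) hlog4.le)
      rw [hg_deriv t ht0, norm_mul, Real.norm_eq_abs, Real.norm_eq_abs,
        abs_of_nonneg (Chebyshev.theta_nonneg _), abs_of_nonpos (by
          have := Real.rpow_pos_of_pos ht0 (-σ - 1); nlinarith), hbound]
      have hpow : t ^ (-σ - 1) * t = t ^ (-σ) := by
        rw [← Real.rpow_add_one ht0.ne']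
        congr 1
        ring
      calc -(-σ * t ^ (-σ - 1)) * θ ((⌊t⌋₊ : ℕ) : ℝ) ≤ -(-σ * t ^ (-σ - 1)) * (Real.log 4 * t) :=
            mul_le_mul_of_nonneg_left hfl (by
              have := Real.rpow_pos_of_pos ht0 (-σ - 1); nlinarith)
        _ = σ * Real.log 4 * (t ^ (-σ - 1) * t) := by ring
        _ = σ * Real.log 4 * t ^ (-σ) := by rw [hpow]
    have hI := norm_integral_le_of_norm_le hbint hle
    -- `∫_N^M σ log 4 t^{-σ} dt = σ log 4 (N^{1-σ} - M^{1-σ})/(σ-1)`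
    have hprim : ∀ t ∈ Set.uIcc (N : ℝ) M,
        HasDerivAt (fun t : ℝ ↦ σ * Real.log 4 * (t ^ (1 - σ) / (1 - σ))) (bound t) t := by
      intro t ht
      rw [Set.uIcc_of_le hNMr] at ht
      have ht0 : 0 < t := by linarith [ht.1]
      have h1 := Real.hasDerivAt_rpow_const (p := 1 - σ) (Or.inl ht0.ne')
      have h2 := (h1.div_const (1 - σ)).const_mul (σ * Real.log 4)
      refine h2.congr_deriv ?_
      rw [hbound]
      simp only
      rw [show (1 : ℝ) - σ - 1 = -σ by ring]
      field_simp [show (1 : ℝ) - σ ≠ 0 by linarith]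
    have hval : ∫ t in Set.Ioc (N : ℝ) M, bound t =
        σ * Real.log 4 * ((M : ℝ) ^ (1 - σ) / (1 - σ)) - σ * Real.log 4 * ((N : ℝ) ^ (1 - σ) / (1 - σ)) := by
      rw [← intervalIntegral.integral_of_le hNMr,
        intervalIntegral.integral_eq_sub_of_hasDerivAt hprim
          ((hbcont.mono (by rw [Set.uIcc_of_le hNMr])).intervalIntegrable)]
    rw [hval] at hI
    have hMpow : 0 ≤ (M : ℝ) ^ (1 - σ) := Real.rpow_nonneg hMpos.le _
    calc ‖∫ t in Set.Ioc (N : ℝ) M, deriv g t * θ (⌊t⌋₊ : ℕ)‖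
        ≤ σ * Real.log 4 * ((M : ℝ) ^ (1 - σ) / (1 - σ)) -
            σ * Real.log 4 * ((N : ℝ) ^ (1 - σ) / (1 - σ)) := hI
      _ = σ * Real.log 4 * ((N : ℝ) ^ (1 - σ) - (M : ℝ) ^ (1 - σ)) / (σ - 1) := by
          have : (1 : ℝ) - σ ≠ 0 := by linarith
          field_simp
          ring
      _ ≤ σ * Real.log 4 * (N : ℝ) ^ (1 - σ) / (σ - 1) := by
          apply div_le_div_of_nonneg_right _ hσ1.le
          nlinarith [mul_pos (by linarith : (0 : ℝ) < σ) hlog4]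
  -- assemble: `x - y - I ≤ x + ‖I‖`
  have hNpow : 0 ≤ (N : ℝ) ^ (1 - σ) := Real.rpow_nonneg hNpos.le _
  have hfin : g M * θ (M : ℝ) - g N * θ (N : ℝ) -
      ∫ t in Set.Ioc (N : ℝ) M, deriv g t * θ (⌊t⌋₊ : ℕ) ≤
      Real.log 4 * (N : ℝ) ^ (1 - σ) + σ * Real.log 4 * (N : ℝ) ^ (1 - σ) / (σ - 1) := by
    have := neg_le_abs (∫ t in Set.Ioc (N : ℝ) M, deriv g t * θ (⌊t⌋₊ : ℕ))
    rw [← Real.norm_eq_abs] at this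
    linarith
  refine hfin.trans ?_
  have hK : 0 ≤ Real.log 4 * (N : ℝ) ^ (1 - σ) := mul_nonneg hlog4.le hNpow
  rw [le_div_iff₀ hσ1]
  have e : (Real.log 4 * (N : ℝ) ^ (1 - σ) + σ * Real.log 4 * (N : ℝ) ^ (1 - σ) / (σ - 1)) *
      (σ - 1) = Real.log 4 * (N : ℝ) ^ (1 - σ) * (2 * σ - 1) := by
    field_simp
    ring
  rw [e]
  nlinarith

/-- Hence `Σ_{N < p ≤ M} p^{-σ} ≤ 3 log 4 · N^{1−σ}/((σ − 1) log N)` (`log p ≥ log N` termwise).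
[folklore] -/
theorem sum_Ioc_prime_rpow_le {σ : ℝ} (hσ : 1 < σ) (hσ2 : σ ≤ 2) {N M : ℕ} (hN : 2 ≤ N)
    (hNM : N ≤ M) :
    ∑ p ∈ (Ioc N M).filter Nat.Prime, (p : ℝ) ^ (-σ) ≤
      3 * Real.log 4 * (N : ℝ) ^ (1 - σ) / ((σ - 1) * Real.log N) := by
  have hNr : (2 : ℝ) ≤ N := by exact_mod_cast hN
  have hlogN : 0 < Real.log N := Real.log_pos (by linarith)
  have h := sum_Ioc_prime_log_mul_rpow_le hσ hσ2 hN hNM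
  have hterm : ∀ p ∈ (Ioc N M).filter Nat.Prime,
      Real.log N * (p : ℝ) ^ (-σ) ≤ Real.log p * (p : ℝ) ^ (-σ) := by
    intro p hp
    rw [mem_filter, mem_Ioc] at hp
    have hp' : (N : ℝ) ≤ p := by exact_mod_cast hp.1.1.le
    exact mul_le_mul_of_nonneg_right (Real.log_le_log (by linarith) hp')
      (Real.rpow_nonneg (Nat.cast_nonneg _) _)
  have h2 : Real.log N * ∑ p ∈ (Ioc N M).filter Nat.Prime, (p : ℝ) ^ (-σ) ≤
      3 * Real.log 4 * (N : ℝ) ^ (1 - σ) / (σ - 1) := by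
    rw [mul_sum]
    exact (sum_le_sum hterm).trans h
  rw [le_div_iff₀ (mul_pos (by linarith) hlogN)]
  rw [le_div_iff₀ (by linarith : (0 : ℝ) < σ - 1)] at h2
  nlinarith

/-- **The prime tail** as an infinite sum over `Nat.Primes`: for `1 < σ ≤ 2` and `N ≥ 2`,
`Σ_{p > N} p^{-σ} ≤ 3 log 4 · N^{1−σ}/((σ − 1) log N)`. With `N ≈ e^{1/(σ−1)}` the right side is
`≪ 1` — "Since `|sin x| ≤ 1`, the sum over `p ≥ e^{1/(σ−1)}` is `≪ Σ_{p > e^{1/(σ−1)}} p^{-σ} ≪ 1`"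
(Montgomery–Vaughan 2001, proof of Lemma 2). [folklore] -/
theorem tsum_primes_rpow_tail_le {σ : ℝ} (hσ : 1 < σ) (hσ2 : σ ≤ 2) {N : ℕ} (hN : 2 ≤ N) :
    ∑' p : Nat.Primes, (if N < (p : ℕ) then ((p : ℕ) : ℝ) ^ (-σ) else 0) ≤
      3 * Real.log 4 * (N : ℝ) ^ (1 - σ) / ((σ - 1) * Real.log N) := by
  have hnn : 0 ≤ fun p : Nat.Primes ↦ (if N < (p : ℕ) then ((p : ℕ) : ℝ) ^ (-σ) else 0) :=
    fun p ↦ by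
      simp only [Pi.zero_apply]
      split_ifs
      · exact Real.rpow_nonneg (Nat.cast_nonneg _) _
      · exact le_rfl
  refine Real.tsum_le_of_sum_le hnn fun u ↦ ?_
  -- push `u` into `ℕ` and compare with the primes of `(N, M]`, `M = max N (sup u)`
  set u' : Finset ℕ := u.map ⟨Subtype.val, Subtype.val_injective⟩ with hu'
  set M : ℕ := max N (u'.sup id) with hM
  have hNM : N ≤ M := le_max_left _ _
  have hsum : ∑ p ∈ u, (if N < (p : ℕ) then ((p : ℕ) : ℝ) ^ (-σ) else 0) =
      ∑ k ∈ u'.filter (fun k ↦ N < k), (k : ℝ) ^ (-σ) := by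
    rw [sum_filter, hu', sum_map]
    rfl
  rw [hsum]
  refine le_trans ?_ (sum_Ioc_prime_rpow_le hσ hσ2 hN hNM)
  refine sum_le_sum_of_subset_of_nonneg (fun k hk ↦ ?_) fun k _ _ ↦
    Real.rpow_nonneg (Nat.cast_nonneg _) _
  rw [mem_filter] at hk ⊢
  obtain ⟨hk, hNk⟩ := hk
  have hkM : k ≤ M := le_trans (le_sup (f := id) hk) (le_max_right _ _)
  have hkprime : k.Prime := by
    rw [hu', mem_map] at hk
    obtain ⟨p, -, rfl⟩ := hk
    exact p.prop
  exact ⟨mem_Ioc.2 ⟨hNk, hkM⟩, hkprime⟩
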